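import Summits.BirchSwinnertonDyer.BirchSwinnertonDyer.Theorems.ByReductionTypeAtTwoRankOneAtTwoOneDoorLawCDefs
import Summits.BirchSwinnertonDyer.Rank1Residual.F1Sign2.BottomLayerAtTwo
import HarnessLib

/-!
# Route ByReductionTypeAtTwo, crux `RankOneAtTwoBigImageOddLocal` (stmt-BirchSwinnertonDyer-23715), LINE v8.12 `one_door_analytic`:
# the CONVERSE half `DoorIndexLawLowerCAtTwo` is VACUOUS on the bottom layer `m = 0`

Width prover seat `bsd-line-fkl-p2` g12 (2026-08-28), `--supports stmt-BirchSwinnertonDyer-23715` (helper).  THEOREMS ONLY (no definition, no named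
fact, no `sorry`).  BSD is not proved by any of this; nothing is asserted about the conjecture-grade stub `stub_doorLowerC` itself.

The skeleton's converse half (AN-28c-L, `RankOneAtTwoOneDoor.DoorIndexLawLowerCAtTwo`, `Theorems/…OneDoorLawCDefs.lean`) reads, at a door datum with
`2`-divisibility exponent `m` of the Heegner point: `2m + [Δ_W < 0] ≤ s_W + s_d + t + 2s + 2·v₂(c)`.  At `m = 0` this carries NO arithmetic: by the
archimedean reciprocity of the door (`transpCount_mod_two_of_doorAdmissible` / `BottomLayer.signIndicator_le_transpCount`: `t ≡ [Δ_W < 0] (mod 2)` for every door-admissible `d`, so `t ≥ 1` when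
`Δ_W < 0`) the right-hand side already dominates `[Δ_W < 0]` — for EVERY door-admissible `d`, every `s_W, s_d, s`, every constant `c`, with no
Heegner point, no `L`-value and no `Ш` in sight.

* (`[Δ_W < 0] ≤ t(W, d)` is the tree's `F1Sign2.BottomLayer.signIndicator_le_transpCount`, planner -an's AN-31 block;)
* `lowerC_conclusion_at_zero` — the `m = 0` instance of the converse inequality, unconditionally;
* `doorIndexLawLowerCAtTwo_at_zero` — `DoorIndexLawLowerCAtTwo`'s statement with its binders VERBATIM and `m := 0`: a THEOREM.

So the converse conjecture's content on this line sits entirely at `m ≥ 1` (a `2`-DIVISIBLE Heegner point forces `2`-torsion in `Ш` or door terms: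
Kolyvagin's conjecture / the rank-one `2`-converse direction), complementing the Euler-system half whose bottom rung (`m = 0`, minimal door) is
PRINT + kernel glue (`doorIndexLawUpperCAtTwoBottom_of_print_ctFree`).

References: [GrossLMS1991] §2 Conj. (2.2), §10; [Kramer1981] Prop. 3; [MazurRubin2010] Prop. 3.3.
-/

set_option autoImplicit false
-- the Theorems namespace of this sub repeats the summit name by design (D-0017 nested layout)
set_option linter.dupNamespace false

noncomputable section

open scoped Classical

namespace Summit.BirchSwinnertonDyer.BirchSwinnertonDyer.Theorems.RankOneAtTwoOneDoor

open WeierstrassCurve NumberField Literature.NumberTheory.EllipticCurves Literature.NumberTheory.EllipticCurves.ModularForms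
  Summit.BirchSwinnertonDyer.Rank1Residual.F1Sign2
  Summit.BirchSwinnertonDyer.Rank1Residual.F1Sign2.TranspositionDoor

/-- **The converse inequality at `m = 0` is unconditional**: `2·0 + [Δ_W < 0] ≤ s_W + s_d + t + 2s + 2·v₂(c)` for every door-admissible `d`,
all `s_W s_d : ℕ` and every `c : ℤ`. [cite: GrossLMS1991, §2 Conj. (2.2)] -/
theorem lowerC_conclusion_at_zero (W : WeierstrassCurve ℚ) [W.IsElliptic] [W.IsGloballyMinimal] {d : ℤ}
    (hadm : DoorAdmissible W d) (sW sd : ℕ) (c : ℤ) :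
    2 * 0 + (if W.Δ < 0 then 1 else 0) ≤ sW + sd + transpCount W d + 2 * identCount W d + 2 * padicValInt 2 c := by
  have h := BottomLayer.signIndicator_le_transpCount W hadm
  omega

/-- **`DoorIndexLawLowerCAtTwo` AT `m = 0` IS A THEOREM** — the converse half's statement with its binders VERBATIM (`…OneDoorLawCDefs.lean`) and the
exponent specialised to `m := 0`: at every door datum of the slice whose Heegner point is not `2`-divisible modulo torsion,
`[Δ_W < 0] ≤ ord₂ #Ш(W)[2^∞] + ord₂ #Ш(W^{(d_K)})[2^∞] + t + 2s + 2·v₂(c)`.  No hypothesis beyond door-admissibility is used (`lowerC_conclusion_at_zero`);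
in particular nothing about `Ш`, the `L`-value or the Heegner point.  Nothing is asserted about `m ≥ 1`. [cite: GrossLMS1991, §2 Conj. (2.2) and §10]
[cite: Kramer1981, Prop. 3] -/
theorem doorIndexLawLowerCAtTwo_at_zero :
    ∀ (W : WeierstrassCurve ℚ) [W.IsElliptic] [W.IsGloballyMinimal] [NeZero (W.conductorNorm ℤ)],
    ¬ W.HasCM → (∀ n : ℕ, W.HasSurjectiveModNGaloisRep ((2 ^ n : ℕ) : ℤ)) → Odd W.torsionOrder → Odd W.tamagawaProduct →
    W.analyticRank = 1 →
    ∀ (K : Type) [Field K] [NumberField K], IsImaginaryQuadratic K →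
      DoorAdmissible W (NumberField.discr K) →
      (W.quadraticTwist (NumberField.discr K : ℚ)).entireLFunction 1 ≠ 0 →
      ∀ (Dt : ModularParametrizationData W (W.conductorNorm ℤ))
        (H : HeegnerDatum (W.conductorNorm ℤ) (NumberField.discr K)) (ι : K →+* ℂ)
        (P : (W.baseChange K).toAffine.Point),
        WeierstrassCurve.Affine.Point.map ι.toRatAlgHom P = heegnerPointComplex Dt H →
        ∀ (Wd : WeierstrassCurve ℚ) [Wd.IsElliptic] [Wd.IsGloballyMinimal] (Cd : WeierstrassCurve.VariableChange ℚ),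
          Cd • W.quadraticTwist (NumberField.discr K : ℚ) = Wd →
          HasTwoDivisibilityUpToTorsion W K P 0 →
            2 * 0 + (if W.Δ < 0 then 1 else 0) ≤
              padicValNat 2 (Nat.card (AddCommGroup.primaryComponent W.sha 2)) +
                padicValNat 2 (Nat.card (AddCommGroup.primaryComponent Wd.sha 2)) +
                transpCount W (NumberField.discr K) + 2 * identCount W (NumberField.discr K) +
                2 * padicValInt 2 Dt.c := by
  intro W _ _ _ _ _ _ _ _ K _ _ _ hadm _ Dt _ _ _ _ Wd _ _ _ _ _
  exact lowerC_conclusion_at_zero W hadm _ _ Dt.c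

/-- **Hence `DoorIndexLawLowerCAtTwo` is equivalent to its restriction to `2`-DIVISIBLE Heegner points (`m ≥ 1`)** — stated without a new
definition: the conjecture follows from its instances at `0 < m`. [cite: GrossLMS1991, §2 Conj. (2.2)] -/
theorem doorIndexLawLowerCAtTwo_of_pos
    (h : ∀ (W : WeierstrassCurve ℚ) [W.IsElliptic] [W.IsGloballyMinimal] [NeZero (W.conductorNorm ℤ)],
      ¬ W.HasCM → (∀ n : ℕ, W.HasSurjectiveModNGaloisRep ((2 ^ n : ℕ) : ℤ)) → Odd W.torsionOrder → Odd W.tamagawaProduct →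
      W.analyticRank = 1 →
      ∀ (K : Type) [Field K] [NumberField K], IsImaginaryQuadratic K →
        DoorAdmissible W (NumberField.discr K) →
        (W.quadraticTwist (NumberField.discr K : ℚ)).entireLFunction 1 ≠ 0 →
        ∀ (Dt : ModularParametrizationData W (W.conductorNorm ℤ))
          (H : HeegnerDatum (W.conductorNorm ℤ) (NumberField.discr K)) (ι : K →+* ℂ)
          (P : (W.baseChange K).toAffine.Point),
          WeierstrassCurve.Affine.Point.map ι.toRatAlgHom P = heegnerPointComplex Dt H →
          ∀ (Wd : WeierstrassCurve ℚ) [Wd.IsElliptic] [Wd.IsGloballyMinimal] (Cd : WeierstrassCurve.VariableChange ℚ),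
            Cd • W.quadraticTwist (NumberField.discr K : ℚ) = Wd →
            ∀ m : ℕ, 0 < m → HasTwoDivisibilityUpToTorsion W K P m →
              2 * m + (if W.Δ < 0 then 1 else 0) ≤
                padicValNat 2 (Nat.card (AddCommGroup.primaryComponent W.sha 2)) +
                  padicValNat 2 (Nat.card (AddCommGroup.primaryComponent Wd.sha 2)) +
                  transpCount W (NumberField.discr K) + 2 * identCount W (NumberField.discr K) +
                  2 * padicValInt 2 Dt.c) :
    DoorIndexLawLowerCAtTwo := by
  intro W _ _ _ hCM hsurj hT hc hr K _ _ hK hadm hLt Dt H ι P hP Wd _ _ Cd hWd m hm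
  rcases Nat.eq_zero_or_pos m with rfl | hpos
  · exact lowerC_conclusion_at_zero W hadm _ _ Dt.c
  · exact h W hCM hsurj hT hc hr K hK hadm hLt Dt H ι P hP Wd Cd hWd m hpos hm

end Summit.BirchSwinnertonDyer.BirchSwinnertonDyer.Theorems.RankOneAtTwoOneDoor

end
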